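import Summits.AnomalousDissipation.AnomalousDissipation.Theses.EulerLimit

/-!
# Birth skeleton (BC3) — crux `EulerLimit.VanishingViscosityRealizationV2` (stmt-AnomalousDissipation-1507)

Route `AnomalousDissipation/EulerLimit` (route-AnomalousDissipation-EulerLimit), item
stmt-AnomalousDissipation-1507, crux rank 2 (the realisation half of thesis X); skeleton registrar
planner-skel-stmt-AnomalousDissipation-1507-0, 2026-08-17.

The crux (`Summit.AnomalousDissipation.AnomalousDissipation.Theses.EulerLimit.VanishingViscosityRealizationV2`):
SOME steady smooth divergence-free mean-zero force `f`, period `τ > 0` and `τ`-periodic field `u` on `ℝ × 𝕋³`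
with `u ∈ C⁰_t C^α_x` (some `α > 0`), weak forced Euler on every `[0,T)`, positive period input `∫₀^τ∫⟪f,u⟫ > 0`,
a NONNEGATIVE Duchon–Robert defect on every `(0,T)`, realised as the strong `L³((0,τ)×𝕋³)` limit (junk-free
nested-`lintegral` clause) of `τ`-periodic CLASSICAL Navier–Stokes solutions `us j` with the SAME force `f` and
viscosities `ν j → 0`.

## The line of this skeleton: ONSAGER-SUBCRITICAL COMPACTNESS (three registered stubs)

Read the crux from the Navier–Stokes side.  If a same-force `τ`-periodic classical family is bounded in a
space–time Hölder class UNIFORMLY IN THE VISCOSITY and keeps its period input (= period dissipation, by the exact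
energy balance) bounded below, then every conclusion of the crux about the limit object is an OUTPUT of two
closure theorems: Arzelà–Ascoli gives a uniformly convergent subsequence whose limit is a `τ`-periodic Hölder weak
Euler flow with the same input (stub 2), and Duchon–Robert's inviscid-limit proposition (forced, classical
approximants) makes its defect the limit of `ν_j|∇u_j|² ≥ 0` (stub 3).  The open physics is isolated in ONE named
existential statement about smooth Navier–Stokes solutions with no limit object, no defect and no convergence
clause in it (stub 1): the Kolmogorov–Onsager picture "bounded in `C^α`, `α ≤ 1/3`, uniformly in `Re`, while
`ε ↛ 0`" (Frisch1995 §5–§8; Onsager 1949; ConstantinETiti1994 / DrivasEyink2019 force `α ≤ 1/3`).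

* `stub_uniformHolderFamily` (HEART, XL, open — the `ν → 0` physics): SOME steady smooth div-free mean-zero `f`,
  `τ > 0`, exponent `α > 0`, constants `C`, `M`, floor `c > 0`, viscosities `ν_j > 0`, `ν_j → 0`, and `τ`-periodic
  CLASSICAL solutions `(us j, ps j)` of `NS(ν_j, f)` on all of `ℝ × 𝕋³` with `HolderWith C α (uncurry (us j))`
  (space–time, uniform in `j`), `‖us j t x‖ ≤ M`, and period input `∫₀^τ∫⟪f, us j⟫ ≥ c` for every `j`.
  WHY IT MIGHT FAIL: it implies the zeroth law itself (period balance `ν_j∫₀^τ‖∇us_j‖² = ∫₀^τ∫⟪f,us_j⟫ ≥ c`,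
  bounded energy from `M`) AND uniform Onsager-subcritical regularity on top — no mechanism produces either for a
  ν-INDEPENDENT force (BrueDeLellis2023 = arXiv:2207.06301 Thm 1.1 / Q.1; BCCDS2024 = arXiv:2212.08413 Thm 1 uses
  `F_ν`; Cheskidov2023 = arXiv:2311.04182 Thm 1.3 uses `f^{ν_j} → f`); uniform `C^α` with `α > 1/3` is IMPOSSIBLE
  (Literature.Barriers.AnomalousDissipation.DrivasEyink2019_lemma1: dissipation would vanish), so the witness lives in
  the window `0 < α ≤ 1/3` and must be genuinely 3-D (BardosTitiWiedemann2012_thm5: shear families select the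
  conservative flow); intermittency may push the uniform pointwise exponent to `0` even when K41 holds on average
  (Frisch1995 Ch. 8, multifractal model: `h_min`).  NOT A COSTUME: no Euler object, no defect, no convergence — it is
  neither the crux (probe fails) nor `ZerothLaw` reworded (classical periodic solutions + uniform Hölder bounds vs.
  Leray–Hopf + `limsup` means; probe fails; the implication stub 1 ⟹ ZerothLaw is the ~150-line Assembly4-type
  argument, recorded here honestly: the stub is summit-strength, as the crux `V2 ⟹ X ⟹ ZerothLaw` already is).
  Sources: Frisch1995 §5.2, Ch. 8; arXiv:2207.06301; arXiv:2212.08413; arXiv:2311.04182; arXiv:1710.05205 (DrivasEyink2019);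
  ConstantinETiti1994; BuckmasterVicol2020 = arXiv:1901.09023 §8 last problem and Rem. 6.4.
* `stub_compactnessClosure` (L–XL, provable with known technology — Arzelà–Ascoli + limit passage): for EVERY such
  uniformly Hölder, uniformly bounded, `τ`-periodic same-force classical family with input `≥ c > 0` there are a
  field `u` and a subsequence `φ` with: `u` `τ`-periodic, `u ∈ C⁰_t C^{α'}_x` for some `α' > 0`
  (`ContinuousInHolderOn univ α' u`, by interpolation from the space–time `C^α` bound of the uniform limit, any
  `α' < α`), `u` a weak solution of forced Euler on every `[0,T)` with datum `u 0` (uniform convergence passes to the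
  limit in `IsWeakNSSolutionForcedOn`; the viscous term is `ν_{φ j}∫⟪us, Δψ⟫ → 0`; classical ⟹ weak for the
  approximants is the discharged bridge `isGlobalLerayHopf_of_isClassicalNSSolutionOn_holds`), period input
  `∫₀^τ∫⟪f,u⟫ ≥ c > 0` (uniform convergence), and `us (φ j) → u` in `L³((0,T)×𝕋³)` for EVERY `T > 0` (uniform
  convergence on `ℝ × 𝕋³` by periodicity; finite measure).  Universally quantified, no existence claim: gives
  neither the crux nor the summit on its own (probes fail).  WHY IT MIGHT FAIL: only by mis-typing (e.g. if
  `ContinuousInHolderOn` demanded the SAME exponent `α`, which uniform `C^α` limits need not have — hence `∃ α'`).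
  Sources: DeLellisSzekelyhidi2013 §2 (Hölder classes `C(I;C^α)`); DiPernaMajda1987 §1; DrivasEyink2019 Thm 2(ii)
  (in tree: `Torus.isWeakEulerSolutionOn_of_inviscidLimit`, unforced twin, PROVED).
* `stub_limitGloballyDissipative` (L, provable with known technology — Duchon–Robert 2000 Prop. 4, FORCED classical
  version): for every smooth div-free steady `f`, `T > 0`, viscosities `ν_j > 0`, `ν_j → 0`, classical solutions
  `(us j, ps j)` of `NS(ν_j, f)` on `ℝ × 𝕋³`, and every weak forced-Euler solution `u` on `[0,T)` which is their
  strong `L³((0,T)×𝕋³)` limit, `u` has a Duchon–Robert defect `D` on `(0,T)` with `D ψ ≥ 0` for nonnegative tests: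
  `D(u) = lim_j ν_j|∇us_j|²` in `𝒟'` (local energy EQUALITY of classical solutions + continuity of the energy-flux
  pairing under `L³`/`L^{3/2}` convergence + the steady force term `⟪f,u_j⟫ → ⟪f,u⟫`).  The UNFORCED Leray–Hopf twin
  is PROVED in tree on `𝕋³` (`Torus.IsDissipationMeasureOf.hasDuchonRobertDefect_holds_fin3`,
  `exists_pressure_of_tendsto_L3_of_card_le_three`, `tendsto_energyFlux_of_tendsto_L3`); the stub is its forced,
  classical-approximant version with the dissipation measure produced inside (weak-* compactness of
  `ν_j|∇us_j|² dx dt`, total mass bounded by the energy balance on `[0,T]`).  Universally quantified: gives neither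
  the crux nor the summit (probes fail).  WHY IT MIGHT FAIL: only by mis-typing (measurability of `u` is supplied by
  the weak-solution hypothesis; `u ∈ L³` follows from the convergence since classical `us j` are bounded on
  `[0,T] × 𝕋³`).  Sources: DuchonRobert2000 Prop. 2, Prop. 4 (p. 253); DrivasEyink2019 = arXiv:1710.05205 §2;
  GiriKwonNovack2023 = arXiv:2305.18509 p. 3; RobinsonRodrigoSadowski2016 Lemma 5.1, Prop. 5.3.

Composition `VanishingViscosityRealizationV2_of` (sorry-free bookkeeping): take `(f, τ)` and the family from stub 1;
stub 2 returns `(u, φ)`; the crux is witnessed by `(f, τ, u, ν ∘ φ, us ∘ φ, ps ∘ φ)` — positivity and classicality /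
periodicity of the reindexed family are those of stub 1 at `φ j`, `ν (φ j) → 0` is `Tendsto.comp` with
`StrictMono.tendsto_atTop`, the Hölder / Euler / input / `L³((0,τ))` clauses are stub 2's conclusions verbatim
(`T := τ`), and the defect clause at level `T` is stub 3 applied to the reindexed family with stub 2's weak-Euler and
`L³((0,T))` conclusions.  `VanishingViscosityRealizationV2_via_stubs` is the skeleton in its final shape (depends on
`sorryAx` through the three stubs only).

Why this cut and not "existence of a globally dissipative periodic Euler flow + a realisation theorem for that
class": the `∀`-form realisation statement over any describable class of convex-integration flows is expected FALSE
or unattackable (BrueDeLellis2023 p. 5 "widely open"; BuckmasterVicol2020 Rem. 6.4: tracking a `C^β` flow costs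
force work `~ν^((3β−1)/(1+β)) → ∞`), so that cut would register a stub nobody can prove or kill.  The compactness
cut instead makes the two closure halves THEOREMS and leaves one honest `∃`-statement whose every clause is an
a-priori property of smooth NS solutions — attackable both ways: by joint construction of `(f, us j)` (BCCDS2024 Thm 1
builds NS families uniformly bounded in `L³_t C^{1/3−}_x` with dissipation bounded below, but with `ν`-dependent forces
`F_ν`; the gaps are the `ν`-independence of ONE steady force, time-periodicity, and `L^∞_t` instead of `L³_t` control),
and by Onsager-type rigidity for NS (a theorem "uniform `C^α` + one steady force ⟹ period input → its laminar
value / 0" for some `α ≤ 1/3` kills the line and is informative for the route's kill criterion).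

## Disproof / negatives honoured

No `Cruxes/VanishingViscosityRealizationV2/Disproof.lean` exists (`ledger crux ls stmt-AnomalousDissipation-1507`,
2026-08-17: no workfiles; this file is the directory's first).  Item evidence read: refuter crux-attack
Evidence1507 (2026-08-15: `V2 → EulerlimitThesisV2`, `V2 → GloballyDissipativePeriodicEulerFlow` by projection;
`D ≥ 0` redundant given the X-body by DuchonRobert2000 Prop. 4 — consistent with stub 3 being a theorem), transfer
lens DICTIONARY.md (2026-08-17: the first non-transferring row of the Isett18/BDLSV19 → BV19 dictionary is exactly
the same-force Leray–Hopf realisation = this item; no new route).  Route barriers: `BuckmasterVicol2019_thm13`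
(c.i. reaches NS only in the weak class) — stub 1 asks for CLASSICAL approximants, i.e. sits squarely on the open
side, not evaded, named; `DrivasEyink2019_lemma1` — respected (`α ≤ 1/3` forced on witnesses, recorded in stub 1's
docstring); `BardosTitiWiedemann2012_thm5` — witnesses must be 3-D; `Cheskidov2023_thm21_noDissipationAnomaly` —
not touched (dissipation is read off the exact period balance of classical flows, stub 1's input floor, never off the
limit's defect).  `ledger negatives --problem AnomalousDissipation` (6 statements, 2026-08-17: 14324, 0204, 13037,
2979, 2984, 2859): none equal or trivially equivalent to any stub (0204/2979/2984 are `∀`-energy-ceiling statements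
over Leray–Hopf families, 13037 a Taylor-certificate pair, 2859 a debris-quanta decay law, 14324 a 2½-D lift).

## BC3 audit (this seat; raw outputs in the seat's NOTES.md `birth-certificate:`)

See NOTES.md of planner-skel-stmt-AnomalousDissipation-1507-0: `lean check --json` rc 0 with `sorries` = 3 = the
three stubs, zero elsewhere; probes `stub → VanishingViscosityRealizationV2` and `stub → AnomalousDissipation` by
`first | exact? | simpa | aesop` (and the BC2 form with `simpa [S] | (unfold S; simpa)`) FAIL for all three stubs.

Shape (D-0027 §3.3, as `Cruxes/GalerkinFloor/Lines/birth.lean`): sorried statements `stub_<name>` with FULL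
signatures over tree declarations only (registered), by-name handles `Statement.stub_<name> : Prop := type_of% …`,
composition `VanishingViscosityRealizationV2_of (h₁ h₂ h₃ : Statement.stub_…) : VanishingViscosityRealizationV2`
sorry-free, and `VanishingViscosityRealizationV2_via_stubs` = the composition applied to the stubs.
-/

noncomputable section

-- D-0017: single-problem summit ⇒ the duplicated namespace segment is by design.
set_option linter.dupNamespace false

open Filter Set MeasureTheory

namespace Summit.AnomalousDissipation.AnomalousDissipation.Cruxes.VanishingViscosityRealizationV2.Birth

open Summit.AnomalousDissipation.AnomalousDissipation.Theses.EulerLimit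

/-- The physical flat unit torus `𝕋³` (local notation). -/
local notation "𝕋³" => UnitAddTorus (Fin 3)
/-- Velocity values (local notation). -/
local notation "E³" => EuclideanSpace ℝ (Fin 3)

/-! ## §1 Registered stubs (the only `sorry`s of the file) -/

/-- **Stub 1 — UNIFORMLY HÖLDER LOUD PERIODIC FAMILY (the `ν → 0` physics; XL, open; summit-strength).**
Some steady smooth divergence-free mean-zero force `f`, a period `τ > 0`, an exponent `α > 0`, constants `C`, `M`
and a floor `c > 0`, positive viscosities `ν_j → 0` and `τ`-periodic CLASSICAL solutions `(us j, ps j)` of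
`NS(ν_j, f)` on all of `ℝ × 𝕋³` such that, uniformly in `j`: `uncurry (us j)` is `(C, α)`-Hölder on `ℝ × 𝕋³`
(sup product metric), `‖us j t x‖ ≤ M`, and the period input `∫₀^τ∫⟪f, us j(t)⟫ ≥ c`.
(Onsager/K41: witnesses need `α ≤ 1/3`, Drivas–Eyink; genuinely 3-D, Bardos–Titi–Wiedemann.)
Why it might fail / sources: see the module docstring. -/
theorem stub_uniformHolderFamily :
    ∃ f : 𝕋³ → E³, Literature.Analysis.FunctionSpaces.Torus.IsSmooth f ∧
      Literature.Analysis.FunctionSpaces.Torus.IsDivFree f ∧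
      Literature.Analysis.FunctionSpaces.Torus.HasZeroMean f ∧
      ∃ (τ : ℝ) (α C : NNReal) (M c : ℝ), 0 < τ ∧ 0 < α ∧ 0 < c ∧
        ∃ (ν : ℕ → ℝ) (us : ℕ → ℝ → 𝕋³ → E³) (ps : ℕ → ℝ → 𝕋³ → ℝ),
          (∀ j, 0 < ν j) ∧ Filter.Tendsto ν Filter.atTop (nhds 0) ∧
          (∀ j, Literature.Analysis.FunctionSpaces.Torus.IsClassicalNSSolutionOn Set.univ (ν j) (fun _ => f)
              (us j) (ps j) ∧ Function.Periodic (us j) τ) ∧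
          (∀ j, HolderWith C α (Function.uncurry (us j))) ∧
          (∀ j t x, ‖us j t x‖ ≤ M) ∧
          (∀ j, c ≤ ∫ t in (0 : ℝ)..τ, MeasureTheory.integral MeasureTheory.volume
              (fun x => inner ℝ (f x) (us j t x))) := by
  sorry

/-- **Stub 2 — COMPACTNESS–CLOSURE (Arzelà–Ascoli + limit passage; L–XL, provable with known technology).**
Every uniformly space–time Hölder, uniformly bounded, `τ`-periodic, same-steady-force classical Navier–Stokes
family with `ν_j → 0⁺` and period input `≥ c > 0` has a subsequence `φ` converging (uniformly, hence) in
`L³((0,T)×𝕋³)` for every `T > 0` to a `τ`-periodic field `u ∈ C⁰_t C^{α'}_x` (some `α' > 0`) which is a weak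
solution of the forced Euler equations on every `[0,T)` with datum `u 0` and has period input `∫₀^τ∫⟪f,u⟫ > 0`.
Why it might fail / sources: see the module docstring. -/
theorem stub_compactnessClosure :
    ∀ (f : 𝕋³ → E³) (τ : ℝ) (α C : NNReal) (M c : ℝ) (ν : ℕ → ℝ) (us : ℕ → ℝ → 𝕋³ → E³)
      (ps : ℕ → ℝ → 𝕋³ → ℝ),
      Literature.Analysis.FunctionSpaces.Torus.IsSmooth f →
      Literature.Analysis.FunctionSpaces.Torus.IsDivFree f →
      0 < τ → 0 < α → 0 < c →
      (∀ j, 0 < ν j) → Filter.Tendsto ν Filter.atTop (nhds 0) →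
      (∀ j, Literature.Analysis.FunctionSpaces.Torus.IsClassicalNSSolutionOn Set.univ (ν j) (fun _ => f)
          (us j) (ps j) ∧ Function.Periodic (us j) τ) →
      (∀ j, HolderWith C α (Function.uncurry (us j))) →
      (∀ j t x, ‖us j t x‖ ≤ M) →
      (∀ j, c ≤ ∫ t in (0 : ℝ)..τ, MeasureTheory.integral MeasureTheory.volume
          (fun x => inner ℝ (f x) (us j t x))) →
      ∃ (u : ℝ → 𝕋³ → E³) (φ : ℕ → ℕ), StrictMono φ ∧ Function.Periodic u τ ∧
        (∃ α' : NNReal, 0 < α' ∧ Literature.Analysis.FunctionSpaces.ContinuousInHolderOn Set.univ α' u) ∧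
        (∀ T : ℝ, 0 < T →
          Literature.Analysis.FluidPDE.Torus.IsWeakNSSolutionForcedOn T 0 (fun _ => f) (u 0) u) ∧
        0 < ∫ t in (0 : ℝ)..τ, MeasureTheory.integral MeasureTheory.volume (fun x => inner ℝ (f x) (u t x)) ∧
        ∀ T : ℝ, 0 < T →
          Filter.Tendsto (fun j => MeasureTheory.lintegral
            (MeasureTheory.Measure.restrict MeasureTheory.volume (Set.Ioo 0 T))
            (fun t => MeasureTheory.lintegral MeasureTheory.volume (fun x => ‖us (φ j) t x - u t x‖ₑ ^ 3)))
            Filter.atTop (nhds 0) := by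
  sorry

/-- **Stub 3 — STRONG `L³` INVISCID LIMITS OF SAME-FORCE CLASSICAL FLOWS ARE GLOBALLY DISSIPATIVE
(Duchon–Robert 2000 Prop. 4, forced classical version; L, provable with known technology).**
For a steady smooth divergence-free force `f`, `T > 0`, viscosities `ν_j > 0`, `ν_j → 0`, classical solutions
`(us j, ps j)` of `NS(ν_j, f)` on `ℝ × 𝕋³`, and a weak forced-Euler solution `u` on `[0,T)` that is their strong
`L³((0,T)×𝕋³)` limit: `u` has a Duchon–Robert defect `D` on `(0,T)` and `D ψ ≥ 0` for every nonnegative test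
function supported in `(0,T)` (`D(u) = lim_j ν_j|∇us_j|²` in `𝒟'`).  Unforced Leray–Hopf twin PROVED in tree:
`Literature.Analysis.FluidPDE.Torus.IsDissipationMeasureOf.hasDuchonRobertDefect_holds_fin3`.
Why it might fail / sources: see the module docstring. -/
theorem stub_limitGloballyDissipative :
    ∀ (f : 𝕋³ → E³) (T : ℝ) (ν : ℕ → ℝ) (us : ℕ → ℝ → 𝕋³ → E³) (ps : ℕ → ℝ → 𝕋³ → ℝ)
      (u : ℝ → 𝕋³ → E³),
      Literature.Analysis.FunctionSpaces.Torus.IsSmooth f →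
      Literature.Analysis.FunctionSpaces.Torus.IsDivFree f →
      0 < T →
      (∀ j, 0 < ν j) → Filter.Tendsto ν Filter.atTop (nhds 0) →
      (∀ j, Literature.Analysis.FunctionSpaces.Torus.IsClassicalNSSolutionOn Set.univ (ν j) (fun _ => f)
          (us j) (ps j)) →
      Literature.Analysis.FluidPDE.Torus.IsWeakNSSolutionForcedOn T 0 (fun _ => f) (u 0) u →
      Filter.Tendsto (fun j => MeasureTheory.lintegral
          (MeasureTheory.Measure.restrict MeasureTheory.volume (Set.Ioo 0 T))
          (fun t => MeasureTheory.lintegral MeasureTheory.volume (fun x => ‖us j t x - u t x‖ₑ ^ 3)))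
          Filter.atTop (nhds 0) →
      ∃ D : Literature.Analysis.FluidPDE.Torus.STFunctional (Fin 3),
        Literature.Analysis.FluidPDE.Torus.HasDuchonRobertDefect T u D ∧
        ∀ ψ : ℝ → 𝕋³ → ℝ, Literature.Analysis.FunctionSpaces.Torus.IsSpaceTimeTestIoo T ψ →
          (∀ t x, 0 ≤ ψ t x) → 0 ≤ D ψ := by
  sorry

/-! ## §2 By-name handles of the registered stubs (hypotheses of the composition; D-0027 §3.3 shape) -/

/-- Statement of registered stub 1 (`stub_uniformHolderFamily`), by name. -/
def Statement.stub_uniformHolderFamily : Prop :=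
  type_of% _root_.Summit.AnomalousDissipation.AnomalousDissipation.Cruxes.VanishingViscosityRealizationV2.Birth.stub_uniformHolderFamily

/-- Statement of registered stub 2 (`stub_compactnessClosure`), by name. -/
def Statement.stub_compactnessClosure : Prop :=
  type_of% _root_.Summit.AnomalousDissipation.AnomalousDissipation.Cruxes.VanishingViscosityRealizationV2.Birth.stub_compactnessClosure

/-- Statement of registered stub 3 (`stub_limitGloballyDissipative`), by name. -/
def Statement.stub_limitGloballyDissipative : Prop :=
  type_of% _root_.Summit.AnomalousDissipation.AnomalousDissipation.Cruxes.VanishingViscosityRealizationV2.Birth.stub_limitGloballyDissipative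

/-! ## §3 Composition (kernel-checked; no `sorry` outside the three stubs) -/

/-- **The skeleton closes the crux BY NAME**:
`stub_uniformHolderFamily → stub_compactnessClosure → stub_limitGloballyDissipative →
EulerLimit.VanishingViscosityRealizationV2`.  Witness `(f, τ, u, ν ∘ φ, us ∘ φ, ps ∘ φ)`: the family and `(f, τ)`
from stub 1, the limit `u` and the subsequence `φ` from stub 2 (Hölder class, weak Euler, input, `L³((0,τ))`
convergence verbatim), the nonnegative defect on each `(0,T)` from stub 3 applied to the reindexed family. -/
theorem VanishingViscosityRealizationV2_of (h₁ : Statement.stub_uniformHolderFamily)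
    (h₂ : Statement.stub_compactnessClosure) (h₃ : Statement.stub_limitGloballyDissipative) :
    VanishingViscosityRealizationV2 := by
  obtain ⟨f, hf, hdf, hmf, τ, α, C, M, c, hτ, hα, hc, ν, us, ps, hν, hν0, hcl, hH, hM, hin⟩ := h₁
  obtain ⟨u, φ, hφ, hper, hHol, hE, hinp, hL3⟩ :=
    h₂ f τ α C M c ν us ps hf hdf hτ hα hc hν hν0 hcl hH hM hin
  have hνφ : Filter.Tendsto (fun j => ν (φ j)) Filter.atTop (nhds 0) := hν0.comp hφ.tendsto_atTop
  refine ⟨f, hf, hdf, hmf, τ, u, hτ, hper, hHol, hE, hinp, ?_, fun j => ν (φ j), fun j => us (φ j),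
    fun j => ps (φ j), fun j => hν (φ j), hνφ, fun j => hcl (φ j), hL3 τ hτ⟩
  intro T hT
  exact h₃ f T (fun j => ν (φ j)) (fun j => us (φ j)) (fun j => ps (φ j)) u hf hdf hT
    (fun j => hν (φ j)) hνφ (fun j => (hcl (φ j)).1) (hE T hT) (hL3 T hT)

/-- The composition applied to the (sorried) stubs: the pipeline closes the crux by name (sorries only
upstream, inside the three registered stubs). -/
theorem VanishingViscosityRealizationV2_via_stubs : VanishingViscosityRealizationV2 :=
  VanishingViscosityRealizationV2_of stub_uniformHolderFamily stub_compactnessClosure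
    stub_limitGloballyDissipative

end Summit.AnomalousDissipation.AnomalousDissipation.Cruxes.VanishingViscosityRealizationV2.Birth

end
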